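import Summits.Ventures.PercRepro.S2TopGraded
import Summits.Ventures.PercRepro.S2MaxExtensionTwoLevelCount

/-!
# PercRepro — S2: THE TOP COUNT BY THE GRADED PARTITION COUNT WITH ONE DISTINGUISHED FLAT; THE UNIQUE BIG RANK-`4` FLAT
(p7, gen 13; sub-claim S2; the cell `(14, 8)`)

**`topCount_le_payment_graded_two`** — `ThmN.topCount_le_payment_graded_of_ext` with the two-level maximal-closure count of
S2MaxExtensionTwoLevelCount (a distinguished rank-`4` flat `G` with `≤ E` maximal extensions, every other rank-`4` flat with `≥ 5` points
with `≤ e`). **`eq_of_rank_four_flats_of_big`** — in the case `k ≥ 4` with `2k ≥ d + 2` two rank-`4` flats of `≥ 4 + k` points coincide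
(their intersection is a flat of rank `≤ 3`, so their union has `≥ 2k + 2` points of rank `≤ 5`, or `≥ 2k + 5` points of nullity `≥ 2k − 1 > d`).
At `(14, 8)`, `ν = 5`: the `9`-point rank-`4` flat is unique. Axioms: standard.
-/

open scoped Matroid

namespace PercRepro

namespace ThmN

open Set

variable {α : Type}

open scoped Classical in
/-- **The top count by the graded partition count, two levels of the maximal-extension bound.** -/
theorem topCount_le_payment_graded_two (M : Matroid α) [M.Finite] (p d : ℕ) (hd6 : 6 ≤ d)
    (hR : M.eRank = (p : ℕ∞)) (hn : M.E.ncard = p + d)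
    (hfree : ∀ e ∈ M.E, ∃ A ⊆ M.E \ {e}, e ∉ M.closure A ∧ e ∉ M.closure ((M.E \ {e}) \ A))
    (f : ℕ) (hflat : ∀ X ⊆ M.E, M.eRk X ≤ 5 → X.ncard ≤ f)
    (s3b s4b s5b : ℕ) (hs3 : {C : Set α | M.IsCircuit C ∧ C.ncard = 3}.ncard ≤ s3b)
    (hs4 : {C : Set α | M.IsCircuit C ∧ C.ncard = 4}.ncard ≤ s4b)
    (hs5 : {C : Set α | M.IsCircuit C ∧ C.ncard = 5}.ncard ≤ s5b)
    (e E : ℕ) (heE : e ≤ E) {G : Set α} (hGE : G ⊆ M.E) (g : ℕ) (hg : G.ncard = g)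
    (hG : ({x ∈ M.E \ G | (M.closure (insert x G)).ncard = f}).ncard ≤ E)
    (he : ∀ P ⊆ M.E, M.closure P = P → M.eRk P = 4 → 5 ≤ P.ncard → P ≠ G →
      ({x ∈ M.E \ P | (M.closure (insert x P)).ncard = f}).ncard ≤ e)
    (V : ℕ) (hV : {B : Set α | B ⊆ M.E ∧ B.ncard = 5 ∧ M.eRk (M.E \ B) = M.eRank}.ncard ≤ V) :
    (Matroid.topCount M p 5 : ℚ) ≤ (V : ℚ) +
      (∑ j ∈ Finset.range (d - 5), (Nat.choose (f - 1 - 6) j : ℚ) / (((j + 1) + 3 * (j + 1).choose 2 + 3 * (j + 1).choose 3 + 2 * (j + 1).choose 4 : ℕ) : ℚ)) *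
        ((s3b * (p + d - 3).choose 3 + s4b * (p + d - 4).choose 2 +
          s5b * (p + d - 5) + (d + 5).choose 6 : ℕ) : ℚ) +
      ((∑ j ∈ Finset.range (d - 5), (Nat.choose (f - 6) j : ℚ) / (((j + 1) + 3 * (j + 1).choose 2 + 3 * (j + 1).choose 3 + 2 * (j + 1).choose 4 : ℕ) : ℚ)) -
        (∑ j ∈ Finset.range (d - 5), (Nat.choose (f - 1 - 6) j : ℚ) / (((j + 1) + 3 * (j + 1).choose 2 + 3 * (j + 1).choose 3 + 2 * (j + 1).choose 4 : ℕ) : ℚ))) *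
        (((s3b * ((((p + d - 3) * (p + d - 3) - (p + d - 3)) * e) + (g * g - g) * (E - e)) +
          s4b * (3 * ((p + d - 4) * e + g * (E - e))) + s5b * (6 * e) + g.choose 5 * (6 * (E - e)) +
          (d + 5).choose 6 * 6 : ℕ) : ℚ) / 6) := by
  classical
  have hL0 : ∀ e ∈ M.E, ¬ M.IsLoop e := not_isLoop_of_free M hfree
  have hs : ∀ e ∈ M.E, ∀ f ∈ M.E, e ≠ f → M.eRk {e, f} = 2 := by
    intro e he f hf hef
    have h2 : (2 : ℕ∞) ≤ M.eRk {e, f} :=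
      two_le_eRk_of_two_le_ncard_of_free M hfree (pair_subset he hf) (by rw [ncard_pair hef])
    have h3 : M.eRk {e, f} ≤ 2 := by
      have := M.eRk_le_encard {e, f}
      rwa [encard_pair hef] at this
    exact le_antisymm h3 h2
  have hcirc : ∀ C, M.IsCircuit C → 3 ≤ C.encard := three_le_encard_of_circuit M hL0 hs
  have hd : M.E.encard = M.eRank + d := by
    rw [hR, ← M.ground_finite.cast_ncard_eq, hn]
    push_cast
    ring
  have hs6 : {C | M.IsCircuit C ∧ C.ncard = 6}.ncard ≤ (d + 5).choose 6 :=
    Matroid.ncard_circuits_le_choose_of_encard M hd 5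
  have hN := S2.card_spanMax_mul_six_le_two (M := M) f e E heE hcirc hGE hG he
  rw [hn, hg] at hN
  refine topCount_le_payment_graded M p d hd6 hR hn hfree f hflat s3b s4b s5b hs3 hs4 hs5 _ (hN.trans ?_) V hV
  gcongr

/-- **Two rank-`4` flats with `≥ 4 + k` points coincide** in the case `k ≥ 4`, `2k ≥ d + 2` (every rank-`≤ 5` set has `≤ 5 + k` points,
planes `≤ 6` points, the core simple). -/
theorem eq_of_rank_four_flats_of_big (M : Matroid α) [M.Finite] {p d k : ℕ} (hR : M.eRank = (p : ℕ∞)) (hn : M.E.ncard = p + d)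
    (hfree : ∀ e ∈ M.E, ∃ A ⊆ M.E \ {e}, e ∉ M.closure A ∧ e ∉ M.closure ((M.E \ {e}) \ A))
    (hflat : ∀ X ⊆ M.E, M.eRk X ≤ 5 → X.ncard ≤ 5 + k) (hk4 : 4 ≤ k) (hkd : d + 2 ≤ 2 * k)
    {P G : Set α} (hPE : P ⊆ M.E) (hPfl : M.closure P = P) (hPr : M.eRk P = 4) (hPk : 4 + k ≤ P.ncard)
    (hGE : G ⊆ M.E) (hGfl : M.closure G = G) (hGr : M.eRk G = 4) (hGk : 4 + k ≤ G.ncard) : P = G := by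
  classical
  have hL0 : ∀ e ∈ M.E, ¬ M.IsLoop e := not_isLoop_of_free M hfree
  have hC2 : ∀ X ⊆ M.E, M.eRk X ≤ 3 → X.ncard ≤ 6 := fun X hX hr =>
    ncard_le_six_of_eRk_le_three_of_free M hfree hX hr
  have hPfin : P.Finite := M.ground_finite.subset hPE
  have hGfin : G.Finite := M.ground_finite.subset hGE
  by_contra hne
  set I := P ∩ G with hIdef
  have hIE : I ⊆ M.E := Set.inter_subset_left.trans hPE
  have hIfl : M.closure I = I := by
    apply le_antisymm
    · intro x hx
      have h1 : x ∈ M.closure P := M.closure_subset_closure Set.inter_subset_left hx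
      have h2 : x ∈ M.closure G := M.closure_subset_closure Set.inter_subset_right hx
      rw [hPfl] at h1; rw [hGfl] at h2
      exact ⟨h1, h2⟩
    · exact M.subset_closure I hIE
  -- the rank of `I` is at most `3`
  have hIr : M.eRk I ≤ 3 := by
    by_contra h4
    push Not at h4
    have hI4 : M.eRk I = 4 := le_antisymm ((M.eRk_mono Set.inter_subset_left).trans hPr.le)
      (Order.add_one_le_of_lt h4)
    -- `P ⊆ cl I = I ⊆ G` and symmetrically
    have hsub : ∀ {F : Set α}, F ⊆ M.E → M.closure F = F → M.eRk F = 4 → I ⊆ F → F ⊆ I := by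
      intro F hFE hFfl hFr hIF x hx
      by_contra hxI
      have hxE : x ∈ M.E := hFE hx
      have h := M.eRk_insert_eq_add_one (X := I) ⟨hxE, by rwa [hIfl]⟩
      have hle : M.eRk (insert x I) ≤ M.eRk F := M.eRk_mono (Set.insert_subset hx hIF)
      rw [h, hI4, hFr] at hle
      norm_num at hle
    exact hne (le_antisymm (hsub hPE hPfl hPr Set.inter_subset_left |>.trans Set.inter_subset_right)
      (hsub hGE hGfl hGr Set.inter_subset_right |>.trans Set.inter_subset_left))
  have hI6 : I.ncard ≤ 6 := hC2 I hIE hIr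
  -- submodularity: `ρ(P ∪ G) ≤ 8 − ρ(I)`
  have hsub := M.eRk_inter_add_eRk_union_le P G
  rw [hPr, hGr] at hsub
  have hPGE : P ∪ G ⊆ M.E := Set.union_subset hPE hGE
  have hcard : (P ∪ G).ncard + I.ncard = P.ncard + G.ncard := Set.ncard_union_add_ncard_inter P G hPfin hGfin
  obtain ⟨u, hu⟩ := ENat.ne_top_iff_exists.1 (S2.eRk_ne_top_of_finite hPGE)
  obtain ⟨i, hi⟩ := ENat.ne_top_iff_exists.1 (S2.eRk_ne_top_of_finite hIE)
  rw [← hu, ← hi] at hsub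
  rw [← hi] at hIr
  have hsub' : i + u ≤ 8 := by exact_mod_cast hsub
  have hi3 : i ≤ 3 := by exact_mod_cast hIr
  -- the nullity of `P ∪ G` is at most `d`
  have hnull : p ≤ u + (p + d - (P ∪ G).ncard) := by
    have h1 : M.eRank ≤ M.eRk (P ∪ G) + (M.E \ (P ∪ G)).encard := by
      have := M.eRk_union_le_eRk_add_encard (P ∪ G) (M.E \ (P ∪ G))
      rwa [Set.union_sdiff_cancel hPGE, M.eRk_ground] at this
    have h2 : (M.E \ (P ∪ G)).encard = ((p + d - (P ∪ G).ncard : ℕ) : ℕ∞) := by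
      rw [← (M.ground_finite.subset Set.sdiff_subset).cast_ncard_eq, Set.ncard_sdiff hPGE (M.ground_finite.subset hPGE), hn]
    rw [hR, h2, ← hu] at h1
    exact_mod_cast h1
  have hPGle : (P ∪ G).ncard ≤ p + d := by
    rw [← hn]; exact Set.ncard_le_ncard hPGE M.ground_finite
  rcases Nat.lt_or_ge i 3 with hi2 | hi3'
  · -- `ρ(I) ≤ 2`: `|I| + 1 ≤ 2^{ρ(I)}`
    have hI3 : I.ncard + 1 ≤ 2 ^ i := ncard_add_one_le_two_pow_of_eRk_le M hL0 hfree i I hIE (le_of_eq hi.symm)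
    interval_cases i <;> omega
  · -- `ρ(I) = 3`: `ρ(P ∪ G) ≤ 5`, so `|P ∪ G| ≤ 5 + k`
    have hu5 : u ≤ 5 := by omega
    have := hflat (P ∪ G) hPGE (by rw [← hu]; exact_mod_cast hu5)
    omega

end ThmN

end PercRepro
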